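import Mathlib.RingTheory.IntegralClosure.IntegrallyClosed
import Mathlib.RingTheory.IntegralClosure.IsIntegralClosure.Basic
import Mathlib.RingTheory.Localization.FractionRing
import Literature.AlgebraicGeometry.Resolution.QuadraticTransforms
import Literature.AlgebraicGeometry.Resolution.LipmanNoEternalNormalBranch
import Literature.AlgebraicGeometry.Resolution.LipmanNoEternalNormalisedBranch
import HarnessLib

/-!
# Lipman's theorem, branch-local form with normalisation — PROVED glue and the swap lemma
# `Lipman1978NoEternalNormalisedBranch → Lipman1978NoEternalNormalBranch`

Companion of `LipmanNoEternalNormalisedBranch.lean` (statements: the step predicate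
`IsNormalisedQuadraticTransform` and the NAMED FACT `Lipman1978NoEternalNormalisedBranch`; Lipman 1978,
THEOREM p. 151 and (1.32)–(1.33) p. 174; Artin 1986, Thm. (1.1); Liu 2002, Thm. 8.3.44) and of the sibling
`LipmanNoEternalNormalBranch.lean` (`Lipman1978NoEternalNormalBranch`: the same theorem followed along a
branch of quadratic transforms that happen to be NORMAL).  Cell `res-hironaka`, rung L, slot W4.1
(`stmt-ResolutionOfSingularities-16345`, res-L0-w41-plan-1 RULING 32a).  Everything here is PROVED (no new
statement of fact):

* `IsNormalisedQuadraticTransform.isLocalRing / .dominates / .le` — projections of the step predicate.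
* `integralClosure_blowupRing_le` — a local ring `R₁ ⊆ K` with fraction field `K`, integrally closed and
  containing a chart `R[𝔪_R/x]`, contains the chart's integral closure in `K` (the normalisation of the
  blow-up is an isomorphism over a point whose local ring is already normal).
* `IsQuadraticTransform.isNormalisedQuadraticTransform` — hence a normal quadratic transform is a normalised
  quadratic transform (Lipman's normal transform (1.32) of a ring whose quadratic transform is already
  normal is that quadratic transform).
* `Lipman1978NoEternalNormalisedBranch.toNormalBranch` — the SWAP LEMMA: the normalised-branch fact implies
  the sibling, so a consumer may carry `(hL' : Lipman1978NoEternalNormalisedBranch)` in place of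
  `(hL : Lipman1978NoEternalNormalBranch)` at no cost in named-fact debt (RULING 18b's «debt-neutral swap»).

References: J. Lipman, Ann. of Math. 107 (1978) 151–207 [Lipman1978]; M. Artin, in Arithmetic Geometry
(Cornell–Silverman eds.), Springer 1986, 267–287, §1, Thm. (1.1) — held text
`book:cornellnd-arithmetic-geometry` p0339–p0340, read on the page 2026-08-27 [Artin1986]; Q. Liu,
*Algebraic Geometry and Arithmetic Curves*, OUP 2002, Thm. 8.3.44 [Liu2002].
-/

noncomputable section

namespace Literature.AlgebraicGeometry.Resolution

universe u

variable {K : Type u} [Field K]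

open IsLocalRing

/-! ## Projections of the step predicate -/

/-- The target of a normalised quadratic transform (Lipman's normal transform (1.32)) is a local ring.
[cite: Lipman1978, (1.32) p. 174] -/
theorem IsNormalisedQuadraticTransform.isLocalRing {R R₁ : Subring K}
    (h : IsNormalisedQuadraticTransform R R₁) : IsLocalRing R₁ := by
  obtain ⟨_, _, -, -, hloc, -⟩ := h
  exact hloc

/-- A normalised quadratic transform (Lipman's normal transform (1.32)) dominates its source.
[cite: Lipman1978, (1.32) p. 174] -/
theorem IsNormalisedQuadraticTransform.dominates {R R₁ : Subring K}
    (h : IsNormalisedQuadraticTransform R R₁) : SubringDominates R R₁ := by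
  obtain ⟨_, _, -, -, -, -, -, hdom⟩ := h
  exact hdom

/-- A normalised quadratic transform (Lipman's normal transform (1.32)) contains its source.
[cite: Lipman1978, (1.32) p. 174] -/
theorem IsNormalisedQuadraticTransform.le {R R₁ : Subring K}
    (h : IsNormalisedQuadraticTransform R R₁) : R ≤ R₁ :=
  h.dominates.1

/-- The chart lies in its integral closure in `K` (plumbing). [folklore] -/
private theorem blowupRing_le_integralClosure (R : Subring K) [IsLocalRing R] (x : K) :
    blowupRing R x ≤ (integralClosure (blowupRing R x) K).toSubring := by
  intro b hb
  rw [Subalgebra.mem_toSubring, mem_integralClosure_iff]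
  exact isIntegral_algebraMap (R := blowupRing R x) (A := K) (x := ⟨b, hb⟩)

/-- **A normal local ring of `K` containing a chart contains the chart's integral closure in `K`.**  If
`R[𝔪_R/x] ⊆ R₁ ⊆ K`, every element of `K` is a fraction of elements of `R₁` (i.e. `K` is the field of
fractions of `R₁`) and `R₁` is integrally closed, then the integral closure of `R[𝔪_R/x]` in `K` lies in
`R₁`: an element of `K` integral over the chart is integral over `R₁`, hence in `R₁`.  (The normalisation of the
blow-up is an isomorphism over a point whose local ring is already normal — the remark that places a branch
of NORMAL quadratic transforms inside the printed procedure «`X_{i+1}` is the normalization of the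
blowing-up», Artin (1.1); Lipman's normal transform (1.32).)
[cite: Lipman1978, (1.32) p. 174; Artin1986, Thm. (1.1) p. 267] -/
theorem integralClosure_blowupRing_le {R R₁ : Subring K} [IsLocalRing R] {x : K}
    (hle : blowupRing R x ≤ R₁) (hK : ∀ z : K, ∃ a ∈ R₁, ∃ b ∈ R₁, b ≠ 0 ∧ z = a / b)
    (hint : IsIntegrallyClosed R₁) :
    (integralClosure (blowupRing R x) K).toSubring ≤ R₁ := by
  intro z hz
  rw [Subalgebra.mem_toSubring, mem_integralClosure_iff] at hz
  haveI : IsFractionRing R₁ K := by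
    refine IsFractionRing.of_field R₁ K fun w => ?_
    obtain ⟨a, ha, b, hb, -, rfl⟩ := hK w
    exact ⟨⟨a, ha⟩, ⟨b, hb⟩, rfl⟩
  letI : Algebra (blowupRing R x) R₁ := (Subring.inclusion hle).toAlgebra
  haveI : IsScalarTower (blowupRing R x) R₁ K := IsScalarTower.of_algebraMap_eq fun _ => rfl
  have hz' : IsIntegral R₁ z := hz.tower_top
  obtain ⟨y, hy⟩ := (IsIntegrallyClosed.isIntegral_iff (R := R₁) (K := K)).mp hz'
  rw [← hy]
  exact y.2

/-- **A normal quadratic transform is a normalised quadratic transform**: if `R₁` is a quadratic transform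
of `R` (a local ring of a chart `R[𝔪_R/x]`), `K` is the field of fractions of `R₁`, and `R₁` is integrally
closed, then the integral closure `N` of the chart lies in `R₁` (`integralClosure_blowupRing_le`) and the
fractions over the chart are fractions over `N`.  (The normalisation is an isomorphism at a point whose
local ring is already normal: a normal quadratic transform IS Lipman's normal transform (1.32), i.e. the
step of Artin's sequence (1.1).) [cite: Lipman1978, (1.32) p. 174; Artin1986, Thm. (1.1) p. 267] -/
theorem IsQuadraticTransform.isNormalisedQuadraticTransform {R R₁ : Subring K}
    (h : IsQuadraticTransform R R₁) (hK : ∀ z : K, ∃ a ∈ R₁, ∃ b ∈ R₁, b ≠ 0 ∧ z = a / b)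
    (hint : IsIntegrallyClosed R₁) : IsNormalisedQuadraticTransform R R₁ := by
  obtain ⟨hR, x, hx, hx0, hR₁, hle, hfrac, hdom⟩ := h
  refine ⟨hR, x, hx, hx0, hR₁, integralClosure_blowupRing_le hle hK hint, fun z hz => ?_, hdom⟩
  obtain ⟨a, ha, b, hb, hbinv, rfl⟩ := hfrac z hz
  exact ⟨a, blowupRing_le_integralClosure R (x : K) ha, b, blowupRing_le_integralClosure R (x : K) hb,
    hbinv, rfl⟩

/-! ## The swap lemma -/

/-- **The swap lemma (debt-neutral)**: the normalised form implies the sibling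
`Lipman1978NoEternalNormalBranch` — a branch of quadratic transforms all of whose members are normal is a
branch of normalised quadratic transforms (`IsQuadraticTransform.isNormalisedQuadraticTransform`; `K` is
the field of fractions of every member because it is that of `R 0 ⊆ R m`).  So a consumer may replace the
hypothesis `(hL : Lipman1978NoEternalNormalBranch)` by `(hL' : Lipman1978NoEternalNormalisedBranch)` and
feed `hL'.toNormalBranch` where `hL` was used.  (Both facts are branch-local forms of the same printed
theorem, Lipman 1978 THEOREM p. 151 / Artin 1986 Thm. (1.1); the implication restores the normalisation
that the sibling's hypotheses make trivial.)
[cite: Lipman1978, Thm. p. 151, (1.32) p. 174; Artin1986, Thm. (1.1) p. 267] -/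
theorem Lipman1978NoEternalNormalisedBranch.toNormalBranch
    (h : Lipman1978NoEternalNormalisedBranch.{u}) : Lipman1978NoEternalNormalBranch.{u} := by
  intro K _ R hof hnoeth hexc hqt hint hdim
  have hmono : ∀ m, R 0 ≤ R m := by
    intro m
    induction m with
    | zero => exact le_rfl
    | succ n ih => exact ih.trans (hqt n).dominates.1
  refine h K R hof hnoeth hexc (fun m => ?_) hint hdim
  refine (hqt m).isNormalisedQuadraticTransform (fun z => ?_) (hint (m + 1))
  obtain ⟨a, ha, b, hb, hb0, rfl⟩ := hof.2 z
  exact ⟨a, hmono (m + 1) ha, b, hmono (m + 1) hb, hb0, rfl⟩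

end Literature.AlgebraicGeometry.Resolution

end
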